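import Literature.NumberTheory.EllipticCurves.ManinSymbolsWeightKGamma1Periods
import Literature.NumberTheory.EllipticCurves.EichlerShimuraPeriodsGamma1RealSpanProofs
import Literature.NumberTheory.EllipticCurves.NewformsSpanGamma1Proofs
import Mathlib.NumberTheory.PrimesCongruentOne
import HarnessLib

/-!
# The rank half of Eichler–Shimura for `Γ₁(N)` in even weight: boundary symbols, Manin's chains,
# and Manin–Drinfeld for the cusps above `∞`

Continuation of `ManinSymbolsWeightK` (formal weight-`k` Manin symbols of `Γ`, the count
`12 dim(M/rel) ≤ (n + 1)[SL(2, ℤ) : Γ]`) and `ManinSymbolsWeightKGamma1Periods` (the period symbols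
of `S_{n+2}(Γ₁(N))`, Manin's trick, `12 dim_ℚ ℚΛ ≤ (n + 1)[SL(2, ℤ) : Γ₁(N)]` for the Eichler–Shimura
period lattice `Λ = periodLatticeK1 n`).  That bound is off by the number of cusps, because the
generators `λ_{σ,q}` of `Λ` (`σ ∈ Γ₀(N)`) are **not** cuspidal symbols: the boundary of
`{∞, σ∞} ⊗ ((σq)₁z - (σq)₀)ⁿ` is `q₁ⁿ[σ∞] - ((σq)₁)ⁿ[∞] ≠ 0`.  This file recovers the cusps for even
`n ≥ 2`:

* **Boundary symbols** (`bdrySymbol`, Merel 1994, §1.4 Prop. 5–6): for `Γ ≤ Γ' ∋ -1` the symbols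
  `[x, q] ↦ q₁ⁿ 𝟙_{orbit x} - q₀ⁿ 𝟙_{orbit S⁻¹x}` with values in `ℚ^{SL(2, ℤ)/Γ'}` (`𝟙_{orbit}` the
  indicator `tind` of a `⟨T⟩`-orbit = cusp of `Γ'`; even `n`, so orientations do not matter) form a
  `PolySymbol`, whose total map has range exactly the span of the orbit indicators
  (`range_total_bdrySymbol`).
* **Manin's chains as elements of the formal module** (`chainMM`, well-founded recursion on
  `|k₁₀|`): their period is `λ_{k,q}` (`total_period_chainMM`) and their boundary is
  `q₁ⁿ 𝟙_{[k⁻¹Γ']} - (kq)₁ⁿ 𝟙_{[Γ']}` (`total_bdry_chainMM`).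
* **The Eisenstein eigenvalue is not cuspidal** (`heckeT_sub_eisenstein_injective`): for a prime
  `p ≡ 1 (mod N)` and `n ≥ 1`, `T_p - (1 + p^{n+1})` is injective on `S_{n+2}(Γ₁(N))` — a
  normalised simultaneous eigenform in its kernel would have `a_{pʲ} = ∑_{i ≤ j} p^{(n+1)i}`,
  against Hecke's bound `aₘ = O(m^{(n+2)/2})`.
* **Manin–Drinfeld for the cusps above `∞`** (`total_bdry_heckeChain`): with all diamond twists
  trivial (`p ≡ 1`), `T_p^∨ λ_{σ,q} = ∑ᵢ λ_{σ'ᵢ, β_{π(i)}q}` (tree: `dualMap_heckeT_periodFunctionalK1`)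
  is the period of the formal chain `∑ᵢ chain(σ'ᵢ, β_{π(i)}q)`, whose boundary is
  `(1 + p^{n+1})` times that of `chain(σ, q)` (the `σ'ᵢ` have the cusp of `σ`, `heckeEps_perm`;
  `∑ᵢ (βᵢv)₁ⁿ = (1 + p^{n+1})v₁ⁿ`).  Hence `Φ = T_p^∨ - (1 + p^{n+1})`, injective, maps `ℚΛ` into
  the periods of boundary-free formal symbols, and
  **`dim_ℚ ℚΛ + dim ⟨orbit indicators of SL(2, ℤ)/Γ'⟩ ≤ dim_ℚ(M/rel)`**
  (`finrank_span_periodLatticeK1_add_le`), i.e. for `N ≥ 4`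
  **`12 (rank_ℤ Λ + #cusps(Γ')) ≤ (n + 1)[SL(2, ℤ) : Γ₁(N)]`** (`twelve_mul_finrank_add_card_le`).

For `Γ' = ±Γ₁(N)` the number of `⟨T⟩`-orbits is the `ε_∞` of the dimension formula
`12 dim S_k(Γ₁(N)) ≥ (k - 1)[SL(2, ℤ) : ±Γ₁(N)] - 6ε_∞` (`ModularFormsGamma1Dimension`), so that
`rank_ℤ Λ ≤ 2 dim_ℂ S_{n+2}(Γ₁(N))` — the rank half of the Eichler–Shimura isomorphism
(Shimura 1971, Thm. 8.4, (8.2.23)) in even weight — follows in the sequel.  Everything here is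
proved; there are no named facts.

## References

* L. Merel, *Universal Fourier expansions of modular forms*, LNM 1585 (1994), §1.2 Prop. 1
  (Manin symbols, Manin's trick), §1.4 Prop. 4–6 (boundary symbols, `∂[P, g]`, surjectivity of `∂`).
* Ju. I. Manin, *Parabolic points and zeta functions of modular curves*, Izv. Akad. Nauk SSSR 36
  (1972), Thm. 1.6; V. G. Drinfeld, *Two theorems on modular curves*, Funct. Anal. Appl. 7 (1973)
  (cusp classes are torsion: the Hecke operator `T_p - p - 1` argument).
* G. Shimura, *Introduction to the arithmetic theory of automorphic functions* (1971), §8.2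
  Thm. 8.4, (8.2.23); §8.3 (8.3.2), Prop. 8.5 (Hecke operators on periods).
-/

noncomputable section
namespace Literature.NumberTheory.EllipticCurves.ModularForms

namespace ManinK

open Module Matrix.SpecialLinearGroup ModularGroup CongruenceSubgroup
open scoped MatrixGroups ModularForm

/-! ### `T`-orbit indicators on a coset space -/

section OrbitInd

variable (Γ' : Subgroup SL(2, ℤ))

open scoped Classical in
/-- The indicator function of the `⟨T⟩`-orbit of a coset `y` (the cusp of `y`). [folklore] -/
def tind (y : Coset Γ') : Coset Γ' → ℚ := fun y' ↦ if ∃ m : ℤ, T ^ m • y = y' then 1 else 0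

variable {Γ'}

/-- `tind` is constant on `⟨T⟩`-orbits. [folklore] -/
theorem tind_T_zpow_smul (m : ℤ) (y : Coset Γ') : tind Γ' (T ^ m • y) = tind Γ' y := by
  funext y'
  simp only [tind]
  congr 1
  apply propext
  constructor
  · rintro ⟨m', h⟩
    exact ⟨m' + m, by rw [zpow_add, mul_smul, h]⟩
  · rintro ⟨m', h⟩
    exact ⟨m' - m, by rw [← h, ← mul_smul, ← zpow_add, sub_add_cancel]⟩

/-- `tind (T y) = tind y`. [folklore] -/
theorem tind_T_smul (y : Coset Γ') : tind Γ' (T • y) = tind Γ' y := by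
  simpa using tind_T_zpow_smul 1 y

/-- `tind (T⁻¹ y) = tind y`. [folklore] -/
theorem tind_T_inv_smul (y : Coset Γ') : tind Γ' (T⁻¹ • y) = tind Γ' y := by
  simpa using tind_T_zpow_smul (-1) y

/-- `tind y y = 1`. [folklore] -/
theorem tind_apply_self (y : Coset Γ') : tind Γ' y y = 1 := by
  simp only [tind]
  rw [if_pos ⟨0, by simp⟩]

/-- If `-1 ∈ Γ'` then `-1` acts trivially on the cosets. [folklore] -/
theorem neg_one_smul_coset (hneg : -1 ∈ Γ') (y : Coset Γ') : (-1 : SL(2, ℤ)) • y = y := by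
  induction y using QuotientGroup.induction_on with
  | H g =>
    rw [MulAction.Quotient.smul_mk, smul_eq_mul, QuotientGroup.eq, neg_one_mul, inv_neg, neg_mul,
      inv_mul_cancel]
    exact hneg

/-- `(-g) y = g y` when `-1 ∈ Γ'`. [folklore] -/
theorem neg_smul_coset' (hneg : -1 ∈ Γ') (g : SL(2, ℤ)) (y : Coset Γ') : (-g) • y = g • y := by
  rw [← neg_one_mul, mul_smul, neg_one_smul_coset hneg]

end OrbitInd

/-! ### Systems of symbols with values in a subspace -/

section Values

variable {n : ℕ} {Γ : Subgroup SL(2, ℤ)} {E : Type*} [AddCommGroup E] [Module ℚ E]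

/-- If all symbols `[x, q]` lie in a subspace `S`, so do all `Sym_x(v)` (the `ev_q` span `V_n`). [folklore] -/
theorem PolySymbol.sym_mem_of_toFun_mem (P : PolySymbol n Γ E) (S : Submodule ℚ E)
    (h : ∀ x q, P.toFun x q ∈ S) (x : Coset Γ) (v : V n) : P.sym x v ∈ S := by
  have hv : v ∈ Submodule.span ℚ (Set.range (ev n)) := by rw [span_ev]; trivial
  induction hv using Submodule.span_induction with
  | mem w hw =>
    obtain ⟨q, rfl⟩ := hw
    rw [PolySymbol.sym_ev]
    exact h x q
  | zero => rw [map_zero]; exact zero_mem _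
  | add w w' _ _ hw hw' => rw [map_add]; exact add_mem hw hw'
  | smul c w _ hw => rw [map_smul]; exact Submodule.smul_mem _ _ hw

/-- If all symbols `[x, q]` lie in a subspace `S`, the total map takes values in `S`. [folklore] -/
theorem PolySymbol.range_total_le [Γ.FiniteIndex] (P : PolySymbol n Γ E) (S : Submodule ℚ E)
    (h : ∀ x q, P.toFun x q ∈ S) : LinearMap.range P.total ≤ S := by
  rintro _ ⟨F, rfl⟩
  rw [PolySymbol.total_apply]
  exact Submodule.sum_mem _ fun x _ ↦ P.sym_mem_of_toFun_mem S h x (F x)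

end Values

/-! ### The boundary symbol system (even `n`) -/

section Bdry

variable (n : ℕ) {Γ Γ' : Subgroup SL(2, ℤ)} (hle : Γ ≤ Γ')

/-- The projection `SL(2, ℤ)/Γ → SL(2, ℤ)/Γ'` for `Γ ≤ Γ'`. [folklore] -/
abbrev proj : Coset Γ → Coset Γ' := Subgroup.quotientMapOfLE hle

/-- The projection is equivariant. [folklore] -/
theorem proj_smul (g : SL(2, ℤ)) (x : Coset Γ) : proj hle (g • x) = g • proj hle x := by
  induction x using QuotientGroup.induction_on with
  | H h => rfl

/-- **The boundary symbol** of `[x, q]`, `x = gΓ`: `q₁ⁿ [g⁻¹∞] - q₀ⁿ [g⁻¹0]`, the cusps recorded as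
the indicators of the `⟨T⟩`-orbits of the cosets `x` and `S⁻¹x` in `SL(2, ℤ)/Γ'` (Merel 1994,
Prop. 6: `∂[P, g] = P(1,0)[Γg(1,0)ᵗ] - P(0,1)[Γg(0,1)ᵗ]`; even `n`, so no orientation signs). [cite: Merel1994, §1.4 Prop. 6] -/
def bdryFun (x : Coset Γ) (q : Fin 2 → ℤ) : Coset Γ' → ℚ :=
  ((q 1 : ℚ) ^ n) • tind Γ' (proj hle x) - ((q 0 : ℚ) ^ n) • tind Γ' (proj hle (S⁻¹ • x))

/-- Unfolding `bdryFun`. [folklore] -/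
theorem bdryFun_def (x : Coset Γ) (q : Fin 2 → ℤ) : bdryFun n hle x q =
    ((q 1 : ℚ) ^ n) • tind Γ' (proj hle x) - ((q 0 : ℚ) ^ n) • tind Γ' (proj hle (S⁻¹ • x)) := rfl

variable {n}

/-- **The boundary symbols form a system of Manin symbols** (even `n ≥ 2`, `-1 ∈ Γ'`): boundaries
of the two-term, three-term and sign relations vanish (`∂² = 0` on the triangle `g∞, g0, g1`).
[cite: Merel1994, §1.4 Prop. 5 and Prop. 6] -/
def bdrySymbol (hn : Even n) (hn1 : 1 ≤ n) (hneg : -1 ∈ Γ') : PolySymbol n Γ (Coset Γ' → ℚ) where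
  toFun := bdryFun n hle
  poly x := by
    refine ⟨fun j ↦ if j = 0 then tind Γ' (proj hle x) else
      if j = n then -tind Γ' (proj hle (S⁻¹ • x)) else 0, fun q ↦ ?_⟩
    have hn0 : n ≠ 0 := by omega
    rw [bdryFun_def, Finset.sum_eq_add_of_mem (a := 0) (b := n) (Finset.mem_range.mpr (by omega))
      (Finset.mem_range.mpr (by omega)) (by omega)]
    · simp [hn0, sub_eq_add_neg]
    · intro j _ hj
      rcases hj with ⟨hj0, hjn⟩
      simp [hj0, hjn]
  two_term x q := by
    rw [bdryFun_def, bdryFun_def, ← mul_smul, ← mul_inv_rev, S_mul_S_eq_neg_one, inv_neg, inv_one,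
      proj_smul hle (-1), neg_one_smul_coset hneg, act_S_inv]
    simp only [Matrix.cons_val_one, Matrix.cons_val_zero, Int.cast_neg, Even.neg_pow hn]
    abel
  three_term x q := by
    have g1 : S⁻¹ * (T * S)⁻¹ = -T⁻¹ := by decide
    have g2 : (T * S)⁻¹ * (T * S)⁻¹ = T * S⁻¹ := by decide
    have g3 : S⁻¹ * ((T * S)⁻¹ * (T * S)⁻¹) = -(T⁻¹ * (T * S)⁻¹) := by decide
    have e1 : tind Γ' (proj hle (S⁻¹ • (T * S)⁻¹ • x)) = tind Γ' (proj hle x) := by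
      rw [← mul_smul, g1, proj_smul, neg_smul_coset' hneg, tind_T_inv_smul]
    have e2 : tind Γ' (proj hle ((T * S)⁻¹ • (T * S)⁻¹ • x)) = tind Γ' (proj hle (S⁻¹ • x)) := by
      rw [← mul_smul, g2, mul_smul, proj_smul hle T, tind_T_smul]
    have e3 : tind Γ' (proj hle (S⁻¹ • (T * S)⁻¹ • (T * S)⁻¹ • x)) =
        tind Γ' (proj hle ((T * S)⁻¹ • x)) := by
      rw [← mul_smul (T * S)⁻¹, ← mul_smul, g3, proj_smul, neg_smul_coset' hneg, mul_smul,
        tind_T_inv_smul, proj_smul]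
    rw [bdryFun_def, bdryFun_def, bdryFun_def, e1, e2, e3, act_TS_inv, act_TS_inv]
    simp only [Matrix.cons_val_one, Matrix.cons_val_zero, Int.cast_sub]
    have : ((q 1 : ℚ) - q 0 - q 1) ^ n = (q 0 : ℚ) ^ n := by
      rw [show ((q 1 : ℚ) - q 0 - q 1) = -(q 0 : ℚ) by ring, Even.neg_pow hn]
    rw [this]
    abel
  neg x q := by
    have hc : S⁻¹ • (-1 : SL(2, ℤ)) • x = (-1 : SL(2, ℤ)) • S⁻¹ • x := by
      rw [← mul_smul, ← mul_smul, mul_neg_one, neg_one_mul]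
    rw [bdryFun_def, bdryFun_def, hc, proj_smul hle (-1), proj_smul hle (-1),
      neg_one_smul_coset hneg, neg_one_smul_coset hneg]
    simp only [Pi.neg_apply, Int.cast_neg, Even.neg_pow hn]

/-- Unfolding the boundary symbols. [folklore] -/
@[simp] theorem bdrySymbol_toFun (hn : Even n) (hn1 : 1 ≤ n) (hneg : -1 ∈ Γ') :
    (bdrySymbol hle hn hn1 hneg).toFun = bdryFun n hle := rfl

variable [Γ.FiniteIndex]

/-- **The boundary symbols span exactly the orbit indicators** (`[x, (0,1)] ↦ 𝟙_{orbit x}`). [cite: Merel1994, §1.4 Prop. 5] -/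
theorem range_total_bdrySymbol (hn : Even n) (hn1 : 1 ≤ n) (hneg : -1 ∈ Γ') :
    LinearMap.range (bdrySymbol hle hn hn1 hneg).total = Submodule.span ℚ (Set.range (tind Γ')) := by
  classical
  apply le_antisymm
  · refine PolySymbol.range_total_le _ _ fun x q ↦ ?_
    rw [bdrySymbol_toFun, bdryFun_def]
    exact sub_mem (Submodule.smul_mem _ _ (Submodule.subset_span ⟨_, rfl⟩))
      (Submodule.smul_mem _ _ (Submodule.subset_span ⟨_, rfl⟩))
  · rw [Submodule.span_le]
    rintro _ ⟨y, rfl⟩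
    induction y using QuotientGroup.induction_on with
    | H g =>
      refine ⟨Pi.single ((g : SL(2, ℤ)) : Coset Γ) (ev n ![0, 1]), ?_⟩
      rw [PolySymbol.total_single, bdrySymbol_toFun, bdryFun_def]
      simp [zero_pow (by omega : n ≠ 0), Subgroup.quotientMapOfLE_apply_mk]

end Bdry

end ManinK

end Literature.NumberTheory.EllipticCurves.ModularForms

namespace Literature.NumberTheory.EllipticCurves.ModularForms

namespace ManinK

open Module Matrix.SpecialLinearGroup ModularGroup CongruenceSubgroup
open scoped MatrixGroups ModularForm

/-! ### Manin's chains as elements of the formal module -/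

section Chain

/-- The Euclid step exponent `m = -⌊k₁₁/k₁₀⌋`. [folklore] -/
def estep (k : SL(2, ℤ)) : ℤ := -(k 1 1 / k 1 0)

/-- The next matrix `k' = kTᵐS` of the continued-fraction descent. [folklore] -/
def enext (k : SL(2, ℤ)) : SL(2, ℤ) := k * T ^ estep k * S

/-- `k'₁₀ = k₁₁ mod k₁₀`. [folklore] -/
theorem enext_apply_one_zero (k : SL(2, ℤ)) : enext k 1 0 = k 1 1 % k 1 0 := by
  simp only [enext, estep, coe_mul, ModularGroup.coe_S, ModularGroup.coe_T_zpow, Matrix.mul_apply,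
    Fin.sum_univ_two]
  simp [Int.emod_def]
  ring

/-- The descent terminates: `|k'₁₀| < |k₁₀|`. [folklore] -/
theorem natAbs_enext_lt {k : SL(2, ℤ)} (hz : k 1 0 ≠ 0) : (enext k 1 0).natAbs < (k 1 0).natAbs := by
  rw [enext_apply_one_zero]
  have h0 := Int.emod_nonneg (k 1 1) hz
  have h1 := Int.emod_lt_abs (k 1 1) hz
  zify
  rw [abs_of_nonneg h0]
  exact h1

variable (n : ℕ) (Γ : Subgroup SL(2, ℤ))

open scoped Classical in
/-- **Manin's chain** of `(k, q)`: the formal sum of Manin symbols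
`e_{(kTᵐ)⁻¹Γ} ⊗ ev_{T⁻ᵐq} + chain(kTᵐS, S⁻¹T⁻ᵐq)`, ending when `k₁₀ = 0` — the continued-fraction
expansion of the path `{∞, k∞}` (Manin 1972, Thm. 1.6). [cite: Merel1994, §1.2 Prop. 1] -/
def chainMM (k : SL(2, ℤ)) (q : Fin 2 → ℤ) : MM n Γ :=
  if hz : k 1 0 = 0 then 0 else
    Pi.single (((k * T ^ estep k)⁻¹ : SL(2, ℤ)) : Coset Γ) (ev n (act (T ^ estep k)⁻¹ q)) +
      chainMM (enext k) (act S⁻¹ (act (T ^ estep k)⁻¹ q))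
  termination_by (k 1 0).natAbs
  decreasing_by exact natAbs_enext_lt hz

open scoped Classical in
/-- Unfolding the chain at a matrix with `k₁₀ = 0`. [folklore] -/
theorem chainMM_of_eq_zero {k : SL(2, ℤ)} (hz : k 1 0 = 0) (q : Fin 2 → ℤ) : chainMM n Γ k q = 0 := by
  rw [chainMM, dif_pos hz]

open scoped Classical in
/-- Unfolding the chain at a matrix with `k₁₀ ≠ 0`. [folklore] -/
theorem chainMM_of_ne_zero {k : SL(2, ℤ)} (hz : k 1 0 ≠ 0) (q : Fin 2 → ℤ) : chainMM n Γ k q =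
    Pi.single (((k * T ^ estep k)⁻¹ : SL(2, ℤ)) : Coset Γ) (ev n (act (T ^ estep k)⁻¹ q)) +
      chainMM n Γ (enext k) (act S⁻¹ (act (T ^ estep k)⁻¹ q)) := by
  rw [chainMM, dif_neg hz]

variable {n Γ} {E : Type*} [AddCommGroup E] [Module ℚ E] [Γ.FiniteIndex]

/-- **The total of a symbol system on a chain**, recursively. [folklore] -/
theorem PolySymbol.total_chainMM_of_ne_zero (P : PolySymbol n Γ E) {k : SL(2, ℤ)} (hz : k 1 0 ≠ 0)
    (q : Fin 2 → ℤ) : P.total (chainMM n Γ k q) =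
      P.toFun (((k * T ^ estep k)⁻¹ : SL(2, ℤ)) : Coset Γ) (act (T ^ estep k)⁻¹ q) +
        P.total (chainMM n Γ (enext k) (act S⁻¹ (act (T ^ estep k)⁻¹ q))) := by
  classical
  rw [chainMM_of_ne_zero n Γ hz, map_add, PolySymbol.total_single]

end Chain

/-! ### The periods and the boundaries of the chains -/

section ChainValues

variable {N : ℕ} [NeZero N] (n : ℕ)

/-- **The period of Manin's chain of `(k, q)` is the path functional `λ_{k,q}`** (telescoping:
`λ_{k,q} = [kTᵐ, T⁻ᵐq] + λ_{kTᵐS, S⁻¹T⁻ᵐq}`, `λ_{±Tᵐ, q} = 0`). [cite: Merel1994, §1.2 Prop. 1] -/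
theorem total_period_chainMM (k : SL(2, ℤ)) (q : Fin 2 → ℤ) :
    (periodSymbol N n).total (chainMM n (Gamma1 N) k q) = pathFnl n k q := by
  suffices H : ∀ m : ℕ, ∀ (k : SL(2, ℤ)) (q : Fin 2 → ℤ), (k 1 0).natAbs = m →
      (periodSymbol N n).total (chainMM n (Gamma1 N) k q) = pathFnl n k q from H _ k q rfl
  intro m
  induction m using Nat.strong_induction_on with
  | _ m ih =>
    intro k q hk
    by_cases hz : k 1 0 = 0
    · rw [chainMM_of_eq_zero n _ hz, map_zero, ← one_mul k, pathFnl_mul_of_apply_one_zero n 1 k hz,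
        pathFnl_one]
    · rw [PolySymbol.total_chainMM_of_ne_zero _ hz,
        ih _ (hk ▸ natAbs_enext_lt hz) (enext k) _ rfl]
      change cosetSym N n _ _ + _ = _
      rw [cosetSym_mk, inv_inv, msymQ_def, enext, sub_add_cancel, pathFnl_mul_T_zpow, act_act_inv]

variable {n} {Γ' : Subgroup SL(2, ℤ)} (hle : Gamma1 N ≤ Γ') (hn : Even n) (hn1 : 1 ≤ n)
  (hneg : -1 ∈ Γ')

include hneg in
/-- An upper-triangular element of `SL(2, ℤ)` lies in the `⟨T⟩`-orbit of `±1`: its coset has the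
orbit indicator of the identity coset (`-1 ∈ Γ'`). [folklore] -/
theorem tind_mk_of_apply_one_zero {k : SL(2, ℤ)} (hz : k 1 0 = 0) :
    tind Γ' ((k : SL(2, ℤ)) : Coset Γ') = tind Γ' ((1 : SL(2, ℤ)) : Coset Γ') := by
  have hdet : k 0 0 * k 1 1 = 1 := by
    have := Matrix.SpecialLinearGroup.det_coe k
    rw [Matrix.det_fin_two, hz, mul_zero, sub_zero] at this
    exact this
  rcases Int.eq_one_or_neg_one_of_mul_eq_one hdet with ha | ha
  · have hd : k 1 1 = 1 := by rw [ha, one_mul] at hdet; exact hdet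
    have hk : k = T ^ (k 0 1) := by
      ext i j
      fin_cases i <;> fin_cases j <;> simp [ModularGroup.coe_T_zpow, ha, hd, hz]
    rw [hk, show ((T ^ (k 0 1) : SL(2, ℤ)) : Coset Γ') = T ^ (k 0 1) • ((1 : SL(2, ℤ)) : Coset Γ') by
      rw [MulAction.Quotient.smul_mk, smul_eq_mul, mul_one], tind_T_zpow_smul]
  · have hd : k 1 1 = -1 := by
      rw [ha] at hdet
      linarith
    have hk : k = -T ^ (-(k 0 1)) := by
      ext i j
      fin_cases i <;> fin_cases j <;>
        simp [ModularGroup.coe_T_zpow, Matrix.SpecialLinearGroup.coe_neg, ha, hd, hz]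
    rw [hk, show ((-T ^ (-(k 0 1)) : SL(2, ℤ)) : Coset Γ') =
        (T ^ (-(k 0 1))) • ((-1 : SL(2, ℤ)) • ((1 : SL(2, ℤ)) : Coset Γ')) by
      rw [← mul_smul, mul_neg_one, MulAction.Quotient.smul_mk, smul_eq_mul, mul_one],
      neg_one_smul_coset hneg, tind_T_zpow_smul]

include hn in
/-- `(kq)₁ⁿ = q₁ⁿ` for upper-triangular `k` and even `n`. [folklore] -/
theorem act_apply_one_pow_of_apply_one_zero {k : SL(2, ℤ)} (hz : k 1 0 = 0) (q : Fin 2 → ℤ) :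
    ((act k q 1 : ℤ) : ℚ) ^ n = ((q 1 : ℤ) : ℚ) ^ n := by
  have hdet : k 0 0 * k 1 1 = 1 := by
    have := Matrix.SpecialLinearGroup.det_coe k
    rw [Matrix.det_fin_two, hz, mul_zero, sub_zero] at this
    exact this
  rw [act_apply_one, hz, zero_mul, zero_add]
  rcases Int.eq_one_or_neg_one_of_mul_eq_one hdet with ha | ha
  · rw [ha, one_mul] at hdet
    rw [hdet, one_mul]
  · rw [ha] at hdet
    have hd : k 1 1 = -1 := by linarith
    rw [hd, neg_one_mul, Int.cast_neg, Even.neg_pow hn]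

/-- `(T⁻ᵐq)₁ = q₁`. [folklore] -/
theorem act_T_zpow_inv_apply_one (m : ℤ) (q : Fin 2 → ℤ) : act (T ^ m)⁻¹ q 1 = q 1 := by
  rw [← zpow_neg, act_apply_one]
  simp [ModularGroup.coe_T_zpow]

include hn in
/-- **The boundary of Manin's chain of `(k, q)`**: `q₁ⁿ 𝟙_{[k∞]} - (kq)₁ⁿ 𝟙_{[∞]}` — the boundary
of the modular symbol `{∞, k∞} ⊗ ((kq)₁z - (kq)₀)ⁿ` (values `det(·, kq)ⁿ` at the primitive vectors
of the two cusps), the cusps `k∞`, `∞` recorded by the orbit indicators of the cosets `k⁻¹Γ'`, `Γ'`.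
[cite: Merel1994, §1.4 Prop. 6] -/
theorem total_bdry_chainMM (k : SL(2, ℤ)) (q : Fin 2 → ℤ) :
    (bdrySymbol hle hn hn1 hneg).total (chainMM n (Gamma1 N) k q) =
      (((q 1 : ℤ) : ℚ) ^ n) • tind Γ' ((k⁻¹ : SL(2, ℤ)) : Coset Γ') -
        (((act k q 1 : ℤ) : ℚ) ^ n) • tind Γ' ((1 : SL(2, ℤ)) : Coset Γ') := by
  suffices H : ∀ m : ℕ, ∀ (k : SL(2, ℤ)) (q : Fin 2 → ℤ), (k 1 0).natAbs = m →
      (bdrySymbol hle hn hn1 hneg).total (chainMM n (Gamma1 N) k q) =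
        (((q 1 : ℤ) : ℚ) ^ n) • tind Γ' ((k⁻¹ : SL(2, ℤ)) : Coset Γ') -
          (((act k q 1 : ℤ) : ℚ) ^ n) • tind Γ' ((1 : SL(2, ℤ)) : Coset Γ') from H _ k q rfl
  intro m
  induction m using Nat.strong_induction_on with
  | _ m ih =>
    intro k q hk
    by_cases hz : k 1 0 = 0
    · have hz' : (k⁻¹ : SL(2, ℤ)) 1 0 = 0 := by
        simp [Matrix.SpecialLinearGroup.coe_inv, Matrix.adjugate_fin_two, hz]
      rw [chainMM_of_eq_zero n _ hz, map_zero, tind_mk_of_apply_one_zero hneg hz',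
        act_apply_one_pow_of_apply_one_zero hn hz q, sub_self]
    · rw [PolySymbol.total_chainMM_of_ne_zero _ hz,
        ih _ (hk ▸ natAbs_enext_lt hz) (enext k) _ rfl, bdrySymbol_toFun, bdryFun_def]
      -- the four orbit indicators and the four coefficients
      have o1 : tind Γ' (proj hle (((k * T ^ estep k)⁻¹ : SL(2, ℤ)) : Coset (Gamma1 N))) =
          tind Γ' ((k⁻¹ : SL(2, ℤ)) : Coset Γ') := by
        change tind Γ' ((((k * T ^ estep k)⁻¹ : SL(2, ℤ)) : Coset Γ')) = _
        rw [mul_inv_rev, ← zpow_neg,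
          show (((T ^ (-estep k)) * k⁻¹ : SL(2, ℤ)) : Coset Γ') = T ^ (-estep k) • ((k⁻¹ : SL(2, ℤ)) : Coset Γ')
            from rfl, tind_T_zpow_smul]
      have o2 : tind Γ' (proj hle (S⁻¹ • (((k * T ^ estep k)⁻¹ : SL(2, ℤ)) : Coset (Gamma1 N)))) =
          tind Γ' (((enext k)⁻¹ : SL(2, ℤ)) : Coset Γ') := by
        rw [MulAction.Quotient.smul_mk, smul_eq_mul]
        change tind Γ' (((S⁻¹ * (k * T ^ estep k)⁻¹ : SL(2, ℤ)) : Coset Γ')) = _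
        rw [enext, mul_inv_rev (k * T ^ estep k) S]
      have c1 : ((act (T ^ estep k)⁻¹ q 1 : ℤ) : ℚ) ^ n = ((q 1 : ℤ) : ℚ) ^ n := by
        rw [act_T_zpow_inv_apply_one]
      have c2 : ((act S⁻¹ (act (T ^ estep k)⁻¹ q) 1 : ℤ) : ℚ) ^ n =
          ((act (T ^ estep k)⁻¹ q 0 : ℤ) : ℚ) ^ n := by
        rw [act_S_inv]
        simp [Even.neg_pow hn]
      have c3 : ((act (enext k) (act S⁻¹ (act (T ^ estep k)⁻¹ q)) 1 : ℤ) : ℚ) ^ n =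
          ((act k q 1 : ℤ) : ℚ) ^ n := by
        rw [enext, ← act_mul, mul_assoc (k * T ^ estep k), mul_inv_cancel, mul_one,
          act_mul, act_act_inv]
      rw [o1, o2, c1, c2, c3]
      abel

end ChainValues

end ManinK

end Literature.NumberTheory.EllipticCurves.ModularForms

namespace Literature.NumberTheory.EllipticCurves.ModularForms

namespace ManinK

open Module Matrix.SpecialLinearGroup ModularGroup CongruenceSubgroup Filter Asymptotics
open scoped MatrixGroups ModularForm Topology

/-! ### `T_p - (1 + p^{k-1})` is injective on `S_k(Γ₁(N))` for `p ≡ 1 (N)`, `k ≥ 3` -/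

section Injective

variable {N : ℕ} [NeZero N]

/-- The partial geometric sums `∑_{i ≤ j} Pⁱ`. [folklore] -/
theorem geom_succ_succ (P : ℂ) (j : ℕ) :
    ∑ i ∈ Finset.range (j + 3), P ^ i =
      (1 + P) * ∑ i ∈ Finset.range (j + 2), P ^ i - P * ∑ i ∈ Finset.range (j + 1), P ^ i := by
  conv_lhs => rw [Finset.sum_range_succ, Finset.sum_range_succ]
  conv_rhs => rw [Finset.sum_range_succ]
  ring

/-- **No cusp form on `Γ₁(N)` of weight `n + 2 ≥ 3` has `T_p`-eigenvalue `1 + p^{n+1}` for a prime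
`p ≡ 1 (mod N)`** (the Eisenstein eigenvalue): otherwise a normalised simultaneous eigenform `g` in
that eigenspace (`exists_common_eigenvector_of_stable`) would have `a_{pʲ}(g) = ∑_{i ≤ j} p^{(n+1)i}`
(Hecke recursion with `⟨p⟩ = 1`), contradicting Hecke's bound `aₘ = O(m^{(n+2)/2})`
(Mathlib `CuspFormClass.qExpansion_isBigO`) since `n + 1 > (n + 2)/2`. This is the injectivity
input of the Manin–Drinfeld argument. [folklore] -/
theorem heckeT_sub_eisenstein_injective {p : ℕ} (hp : p.Prime) [NeZero p] (hpN : (p : ZMod N) = 1)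
    {n : ℕ} (hn : 1 ≤ n) :
    Function.Injective
      (heckeT (Gamma1 N) (n + 2) p -
        ((1 : ℂ) + (p : ℂ) ^ (n + 1)) • (LinearMap.id : Module.End ℂ (CuspForm (Gamma1 N) (n + 2)))) := by
  set c : ℂ := 1 + (p : ℂ) ^ (n + 1) with hc
  rw [← LinearMap.ker_eq_bot]
  by_contra hE
  set E : Submodule ℂ (CuspForm (Gamma1 N) (n + 2)) :=
    LinearMap.ker (heckeT (Gamma1 N) (n + 2) p - c • LinearMap.id) with hEdef
  have hmemE : ∀ {v}, v ∈ E ↔ heckeT (Gamma1 N) (n + 2) p v = c • v := fun {v} ↦ by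
    rw [hEdef, LinearMap.mem_ker, LinearMap.sub_apply, LinearMap.smul_apply, LinearMap.id_apply,
      sub_eq_zero]
  have hTp_mem : heckeT (Gamma1 N) (n + 2) p ∈ heckeGens1 N (n + 2) := Or.inl ⟨p, hp, rfl⟩
  have hstab : ∀ T ∈ heckeGens1 N (n + 2), ∀ v ∈ E, T v ∈ E := by
    intro T hT v hv
    rw [hmemE] at hv ⊢
    have hcomm := heckeGens1_comm T hT _ hTp_mem
    have := congrArg (fun F : Module.End ℂ (CuspForm (Gamma1 N) (n + 2)) ↦ F v) hcomm
    simp only [Module.End.mul_apply] at this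
    rw [← this, hv, map_smul]
  obtain ⟨g, hgE, hg0, hgeig⟩ := exists_common_eigenvector_of_stable (heckeGens1 N (n + 2))
    heckeGens1_comm _ E inferInstance rfl hE hstab
  have hHE : IsHeckeEigen g := isHeckeEigen_of_forall_heckeGens1 hgeig
  have ha1 : cuspCoeff g 1 ≠ 0 := hHE.cuspCoeff_one_ne_zero hg0
  have hTp : heckeT (Gamma1 N) (n + 2) p g = c • g := hmemE.mp hgE
  have hdia : diamondOp N (n + 2) (p : ZMod N) g = g := by
    rw [hpN, diamondOp_one_eq_id, LinearMap.id_apply]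
  have hpN' : ¬ p ∣ N := by
    intro hdvd
    have h1 : ((p - 1 : ℕ) : ZMod N) = 0 := by
      rw [Nat.cast_sub hp.one_le, hpN, Nat.cast_one, sub_self]
    rw [CharP.cast_eq_zero_iff (ZMod N) N] at h1
    have h2 := hp.two_le
    have := Nat.le_of_dvd (by omega) (hdvd.trans h1)
    omega
  -- the recursion `a_{pm} = c aₘ - p^{n+1} [p ∣ m] a_{m/p}`
  have hrec : ∀ m, cuspCoeff g (p * m) =
      c * cuspCoeff g m - (p : ℂ) ^ (n + 1) * (if p ∣ m then cuspCoeff g (m / p) else 0) := by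
    intro m
    have h := qExpansion_coeff_heckeT_gamma1_holds N (n + 2) g p hp m
    rw [if_neg hpN', hTp] at h
    change cuspCoeff (c • g) m = cuspCoeff g (p * m) + (p : ℂ) ^ ((n : ℤ) + 2 - 1) *
      (if p ∣ m then cuspCoeff (diamondOp N (n + 2) (p : ZMod N) g) (m / p) else 0) at h
    rw [cuspCoeff_smul_gamma1, hdia, show ((n : ℤ) + 2 - 1) = ((n + 1 : ℕ) : ℤ) by push_cast; ring,
      zpow_natCast] at h
    linear_combination -h
  -- closed form `a_{pʲ} = (∑_{i ≤ j} Pⁱ) a₁`, `P = p^{n+1}`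
  set P : ℂ := (p : ℂ) ^ (n + 1) with hP
  have hpow : ∀ j, cuspCoeff g (p ^ j) = (∑ i ∈ Finset.range (j + 1), P ^ i) * cuspCoeff g 1 := by
    intro j
    induction j using Nat.twoStepInduction with
    | zero => simp
    | one =>
      have h := hrec 1
      rw [mul_one, if_neg (by rw [Nat.dvd_one]; exact hp.one_lt.ne')] at h
      rw [pow_one, h, Finset.sum_range_succ, Finset.sum_range_one, pow_zero, pow_one, hc, hP]
      ring
    | more j ih1 ih2 =>
      have h := hrec (p ^ (j + 1))
      have hdiv : p ^ (j + 1) / p = p ^ j := by rw [pow_succ', Nat.mul_div_cancel_left _ hp.pos]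
      have hmul : p * p ^ (j + 1) = p ^ (j + 2) := by ring
      have e : j + 1 + 1 = j + 2 := rfl
      rw [if_pos (dvd_pow_self p (Nat.succ_ne_zero j)), hdiv, hmul] at h
      rw [e] at ih2
      rw [h, ih1, ih2, geom_succ_succ, hc]
      ring
  -- the sums are real and at least `Pʲ`
  have hsum_re : ∀ j, (∑ i ∈ Finset.range (j + 1), P ^ i) = ((∑ i ∈ Finset.range (j + 1),
      (p : ℝ) ^ ((n + 1) * i) : ℝ) : ℂ) := fun j ↦ by
    rw [hP]; push_cast; refine Finset.sum_congr rfl fun i _ ↦ by rw [pow_mul]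
  have hsum_ge : ∀ j, (p : ℝ) ^ ((n + 1) * j) ≤ ∑ i ∈ Finset.range (j + 1), (p : ℝ) ^ ((n + 1) * i) :=
    fun j ↦ Finset.single_le_sum (f := fun i ↦ (p : ℝ) ^ ((n + 1) * i)) (fun i _ ↦ by positivity)
      (Finset.self_mem_range_succ j)
  -- Hecke's bound
  have hbig := CuspFormClass.qExpansion_isBigO g
  rw [strictWidthInfty_Gamma1] at hbig
  obtain ⟨C, hC⟩ := Asymptotics.isBigO_iff.mp hbig
  rw [eventually_atTop] at hC
  obtain ⟨m₀, hm₀⟩ := hC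
  -- `|a₁| p^{(n+1)j} ≤ C p^{j(n+2)/2}` for `pʲ ≥ m₀`
  have hp1 : (1 : ℝ) < p := by exact_mod_cast hp.one_lt
  have key : ∀ j : ℕ, m₀ ≤ p ^ j →
      ‖cuspCoeff g 1‖ * ((p : ℝ) ^ ((n : ℝ) / 2)) ^ j ≤ C := by
    intro j hj
    have h := hm₀ (p ^ j) hj
    have hp0 : (0 : ℝ) ≤ p := by positivity
    have hppos : (0 : ℝ) < p := by positivity
    -- the right-hand side of Hecke's bound at `m = pʲ`
    set A : ℝ := ((p ^ j : ℕ) : ℝ) ^ ((((n : ℤ) + 2 : ℤ) : ℝ) / 2) with hA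
    have hApos : 0 < A := by
      rw [hA]
      exact Real.rpow_pos_of_pos (by exact_mod_cast pow_pos hp.pos j) _
    have hnormA : ‖A‖ = A := Real.norm_of_nonneg hApos.le
    have hprod : A * ((p : ℝ) ^ ((n : ℝ) / 2)) ^ j = (p : ℝ) ^ ((n + 1) * j) := by
      rw [hA, Nat.cast_pow, ← Real.rpow_natCast (p : ℝ) j, ← Real.rpow_mul hp0,
        ← Real.rpow_natCast ((p : ℝ) ^ ((n : ℝ) / 2)) j, ← Real.rpow_mul hp0, ← Real.rpow_add hppos,
        ← Real.rpow_natCast (p : ℝ) ((n + 1) * j)]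
      congr 1
      push_cast
      ring
    change ‖cuspCoeff g (p ^ j)‖ ≤ C * ‖A‖ at h
    rw [hnormA, hpow j, hsum_re, norm_mul, Complex.norm_real, Real.norm_of_nonneg
      (Finset.sum_nonneg fun i _ ↦ by positivity)] at h
    have hle := (mul_le_mul_of_nonneg_right (hsum_ge j) (norm_nonneg (cuspCoeff g 1))).trans h
    rw [← hprod] at hle
    -- `A (p^{n/2})ʲ ‖a₁‖ ≤ C A`
    have : A * (((p : ℝ) ^ ((n : ℝ) / 2)) ^ j * ‖cuspCoeff g 1‖) ≤ A * C := by nlinarith [hle]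
    have := le_of_mul_le_mul_left this hApos
    linarith
  -- but `(p^{n/2})ʲ → ∞`
  have hr : (1 : ℝ) < (p : ℝ) ^ ((n : ℝ) / 2) :=
    Real.one_lt_rpow hp1 (by have h0 : (0 : ℝ) < n := (by exact_mod_cast hn); linarith)
  have ht := tendsto_pow_atTop_atTop_of_one_lt hr
  have hev := ht.eventually_gt_atTop (C / ‖cuspCoeff g 1‖)
  rw [eventually_atTop] at hev
  obtain ⟨j₀, hj₀⟩ := hev
  -- choose `j ≥ j₀` with `pʲ ≥ m₀`
  obtain ⟨j₁, hj₁⟩ : ∃ j₁ : ℕ, m₀ ≤ p ^ j₁ := ⟨m₀, (Nat.lt_pow_self hp.one_lt).le⟩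
  have hjm : m₀ ≤ p ^ (max j₀ j₁) := hj₁.trans (Nat.pow_le_pow_right hp.pos (le_max_right _ _))
  have h1 := key _ hjm
  have h2 := hj₀ (max j₀ j₁) (le_max_left _ _)
  have ha : 0 < ‖cuspCoeff g 1‖ := norm_pos_iff.mpr ha1
  rw [div_lt_iff₀ ha] at h2
  rw [mul_comm] at h1
  linarith

end Injective

end ManinK

end Literature.NumberTheory.EllipticCurves.ModularForms

namespace Literature.NumberTheory.EllipticCurves.ModularForms

namespace ManinK

open Module Matrix.SpecialLinearGroup ModularGroup CongruenceSubgroup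
open scoped MatrixGroups ModularForm

/-! ### The formal Hecke operator on the generators and its boundary (`p ≡ 1 mod N`) -/

section FormalHecke

variable {N : ℕ} [NeZero N] (n : ℕ) {p : ℕ} [NeZero p] (hp : p.Prime)

omit [NeZero N] [NeZero p] in
/-- For `p ≡ 1 (mod N)` all the diamond twists `εᵢ` in `T_p = ∑ᵢ ⟨εᵢ⟩(·)|βᵢ` are trivial. [folklore] -/
theorem heckeEps_eq_one (hpN : (p : ZMod N) = 1) (i : HeckeIdx N p) : heckeEps N p i.1 = 1 := by
  rcases i with ⟨_ | j, hi⟩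
  · simp [heckeEps, hpN]
  · simp [heckeEps]

include hp in
/-- **The formal Hecke image of a generator**: `∑ᵢ chain(σ'ᵢ, β_{π(i)} q)`, where `βᵢ σ = σ'ᵢ β_{π(i)}`
(`heckePermElt`, `heckePerm` of `EichlerShimuraPeriods`). [cite: ShimuraIATAF1971, §8.3 (8.3.2)] -/
def heckeChain (σ : Gamma0 N) (q : Fin 2 → ℤ) : MM n (Gamma1 N) :=
  ∑ i : HeckeIdx N p, chainMM n (Gamma1 N) (heckePermElt hp σ i : SL(2, ℤ))
    ((heckeRep p (heckePerm hp σ i).1).mulVec q)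

/-- **Its period is `T_p^∨ λ_{σ,q}`** when `p ≡ 1 (mod N)` (`dualMap_heckeT_periodFunctionalK1` with all
twists trivial). [cite: ShimuraIATAF1971, §8.3 (8.3.2) and Prop. 8.5] -/
theorem total_period_heckeChain (hpN : (p : ZMod N) = 1) (σ : Gamma0 N) (q : Fin 2 → ℤ) :
    (periodSymbol N n).total (heckeChain n hp σ q) =
      (heckeT (Gamma1 N) (n + 2) p).dualMap (periodFunctionalK1 n σ q) := by
  rw [heckeChain, map_sum, dualMap_heckeT_periodFunctionalK1 hp]
  refine Finset.sum_congr rfl fun i _ ↦ ?_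
  rw [total_period_chainMM, heckeEps_eq_one hpN, diamondOp_one_eq_id, LinearMap.dualMap_id,
    LinearMap.id_apply]
  rfl

omit [NeZero N] in
/-- **`∑ᵢ (βᵢv)₁ⁿ = (1 + p^{n+1}) v₁ⁿ`** over the `p + 1` representatives `(1 j; 0 p)`, `(p 0; 0 1)`
(`p ∤ N`): the Eisenstein eigenvalue of `T_p` on the boundary symbol of `∞`. [cite: Merel1994, §1.4 Prop. 5] -/
theorem sum_heckeRep_mulVec_one_pow (hpN' : ¬ p ∣ N) (v : Fin 2 → ℤ) :
    ∑ i : HeckeIdx N p, ((((heckeRep p i.1).mulVec v) 1 : ℤ) : ℚ) ^ n =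
      ((1 : ℚ) + (p : ℚ) ^ (n + 1)) * ((v 1 : ℤ) : ℚ) ^ n := by
  rw [sum_heckeIdx N p fun i ↦ ((((heckeRep p i).mulVec v) 1 : ℤ) : ℚ) ^ n, if_neg hpN']
  have hs : ∀ j : ZMod p, ((((heckeRep p (some j)).mulVec v) 1 : ℤ) : ℚ) ^ n =
      (p : ℚ) ^ n * ((v 1 : ℤ) : ℚ) ^ n := fun j ↦ by
    simp [heckeRep, Matrix.mulVec, dotProduct, Fin.sum_univ_two, mul_pow]
  have hnone : ((((heckeRep p none).mulVec v) 1 : ℤ) : ℚ) ^ n = ((v 1 : ℤ) : ℚ) ^ n := by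
    simp [heckeRep, Matrix.mulVec, dotProduct, Fin.sum_univ_two]
  simp_rw [hs]
  rw [hnone, Finset.sum_const, Finset.card_univ, ZMod.card, nsmul_eq_mul, pow_succ]
  ring

variable {n} {Γ' : Subgroup SL(2, ℤ)} (hle : Gamma1 N ≤ Γ') (hn : Even n) (hn1 : 1 ≤ n)
  (hneg : -1 ∈ Γ')

/-- **The boundary of the formal Hecke image is `(1 + p^{n+1})` times the boundary** (`p ≡ 1 mod N`):
the permuted matrices `σ'ᵢ` have the same lower-right entry as `σ` mod `N` (`heckeEps_perm`), hence
the same cusp, and `∑ᵢ (β_{π(i)}q)₁ⁿ = ∑ᵢ (βᵢσq)₁ⁿ/(σq)₁ⁿ · … = (1 + p^{n+1})(·)` — the Eisenstein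
eigenvalue at the cusps above `∞`; this is the Manin–Drinfeld input. [cite: Merel1994, §1.4 Prop. 5 and Prop. 6] -/
theorem total_bdry_heckeChain (hpN : (p : ZMod N) = 1) (σ : Gamma0 N) (q : Fin 2 → ℤ) :
    (bdrySymbol hle hn hn1 hneg).total (heckeChain n hp σ q) =
      ((1 : ℚ) + (p : ℚ) ^ (n + 1)) • (bdrySymbol hle hn hn1 hneg).total (chainMM n (Gamma1 N) σ q) := by
  have hpN' : ¬ p ∣ N := by
    intro hdvd
    have h1 : ((p - 1 : ℕ) : ZMod N) = 0 := by
      rw [Nat.cast_sub hp.one_le, hpN, Nat.cast_one, sub_self]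
    rw [CharP.cast_eq_zero_iff (ZMod N) N] at h1
    have h2 := hp.two_le
    have := Nat.le_of_dvd (by omega) (hdvd.trans h1)
    omega
  -- the cusps of the `σ'ᵢ` are the cusp of `σ`
  have hcos : ∀ i : HeckeIdx N p,
      tind Γ' ((((heckePermElt hp σ i : SL(2, ℤ)))⁻¹ : SL(2, ℤ)) : Coset Γ') =
        tind Γ' ((((σ : SL(2, ℤ)))⁻¹ : SL(2, ℤ)) : Coset Γ') := by
    intro i
    have h := heckeEps_perm hp σ i
    rw [heckeEps_eq_one hpN, heckeEps_eq_one hpN, one_mul, one_mul] at h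
    congr 1
    rw [QuotientGroup.eq, inv_inv]
    apply hle
    have hmap : Gamma0Map N (heckePermElt hp σ i * σ⁻¹) = 1 := by
      have hu := isUnit_Gamma0Map N σ
      rw [← hu.mul_left_inj, ← map_mul, inv_mul_cancel_right, one_mul, h]
    exact mem_gamma1_of_gamma0Map_eq_one N hmap
  -- the second coefficients: `σ'ᵢ β_{π(i)} q = βᵢ σ q`
  have hsnd : ∀ i : HeckeIdx N p,
      act (heckePermElt hp σ i : SL(2, ℤ)) ((heckeRep p (heckePerm hp σ i).1).mulVec q) =
        (heckeRep p i.1).mulVec (act σ q) := by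
    intro i
    rw [act, act, Matrix.mulVec_mulVec, heckePermElt_spec hp σ i, ← Matrix.mulVec_mulVec]
  rw [heckeChain, map_sum]
  simp_rw [total_bdry_chainMM hle hn hn1 hneg, hcos, hsnd]
  rw [Finset.sum_sub_distrib, ← Finset.sum_smul, ← Finset.sum_smul,
    Fintype.sum_equiv (heckePermEquiv hp σ)
      (fun i : HeckeIdx N p ↦ ((((heckeRep p (heckePerm hp σ i).1).mulVec q) 1 : ℤ) : ℚ) ^ n)
      (fun j : HeckeIdx N p ↦ ((((heckeRep p j.1).mulVec q) 1 : ℤ) : ℚ) ^ n) (fun i ↦ rfl),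
    sum_heckeRep_mulVec_one_pow n hpN', sum_heckeRep_mulVec_one_pow n hpN', smul_sub, ← mul_smul,
    ← mul_smul]

end FormalHecke

/-! ### The count: `rank Λ + #cusps ≤ dim M/rel` -/

section Count

variable (N : ℕ) [NeZero N] {n : ℕ} {Γ' : Subgroup SL(2, ℤ)}
  (hle : Gamma1 N ≤ Γ') (hn : Even n) (hn1 : 1 ≤ n) (hneg : -1 ∈ Γ')

include hle hn hn1 hneg

/-- **Manin–Drinfeld for the cusps above `∞`, in dimension form**:
`dim_ℚ ℚΛ + dim_ℚ ⟨orbit indicators of SL(2, ℤ)/Γ'⟩ ≤ dim_ℚ (M/rel)` for the Eichler–Shimura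
period lattice `Λ = periodLatticeK1 n` of `S_{n+2}(Γ₁(N))` (`n ≥ 2` even, `Γ₁(N) ≤ Γ' ∋ -1`).
With a prime `p ≡ 1 (mod N)` (Dirichlet, Mathlib `Nat.exists_prime_gt_modEq_one`),
`Φ = T_p^∨ - (1 + p^{n+1})` is injective on `S^∨` (`heckeT_sub_eisenstein_injective`) and maps every
generator `λ_{σ,q}` to the period of a formal symbol with zero boundary
(`total_bdry_heckeChain`), so `dim ℚΛ = dim Φ(ℚΛ) ≤ dim P(ker ∂) ≤ dim ker ∂ = dim(M/rel) - rank ∂`,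
and `rank ∂ = dim ⟨orbit indicators⟩` (`range_total_bdrySymbol`). [cite: Merel1994, §1.4 Prop. 5] -/
theorem finrank_span_periodLatticeK1_add_le :
    Module.finrank ℚ (Submodule.span ℚ (periodLatticeK1 (N := N) n :
        Set (Module.Dual ℂ (CuspForm (Gamma1 N) (n + 2))))) +
      Module.finrank ℚ (Submodule.span ℚ (Set.range (tind Γ'))) ≤
        Module.finrank ℚ (MM n (Gamma1 N) ⧸ relK n (Gamma1 N)) := by
  classical
  -- a prime `p ≡ 1 (mod N)`
  obtain ⟨p, hp, -, hpmod⟩ := Nat.exists_prime_gt_modEq_one 0 (NeZero.ne N)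
  haveI : NeZero p := ⟨hp.ne_zero⟩
  have hpN : (p : ZMod N) = 1 := by
    have := (ZMod.natCast_eq_natCast_iff p 1 N).mpr hpmod
    rwa [Nat.cast_one] at this
  set P := periodSymbol N n with hPdef
  set B := bdrySymbol hle hn hn1 hneg with hBdef
  set R := relK n (Gamma1 N) with hRdef
  set Pbar := R.liftQ P.total P.relK_le_ker with hPbar
  set Bbar := R.liftQ B.total B.relK_le_ker with hBbar
  set c : ℂ := 1 + (p : ℂ) ^ (n + 1) with hc
  -- `Φ = (T_p - c)^∨` as a `ℚ`-linear injective endomorphism of the dual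
  set Φℂ := (heckeT (Gamma1 N) (n + 2) p -
    c • (LinearMap.id : Module.End ℂ (CuspForm (Gamma1 N) (n + 2)))).dualMap with hΦℂ
  have hΦinj : Function.Injective Φℂ := by
    rw [hΦℂ, LinearMap.dualMap_injective_iff]
    exact (LinearMap.injective_iff_surjective).mp (heckeT_sub_eisenstein_injective hp hpN hn1)
  set Φ : Module.Dual ℂ (CuspForm (Gamma1 N) (n + 2)) →ₗ[ℚ]
    Module.Dual ℂ (CuspForm (Gamma1 N) (n + 2)) := Φℂ.restrictScalars ℚ with hΦ
  have hΦinj' : Function.Injective Φ := hΦinj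
  have hΦapply : ∀ φ, Φ φ = (heckeT (Gamma1 N) (n + 2) p).dualMap φ - c • φ := fun φ ↦ by
    rw [hΦ, LinearMap.restrictScalars_apply, hΦℂ]
    ext f
    simp [LinearMap.dualMap_apply]
  -- the cuspidal periods
  set C : Submodule ℚ (Module.Dual ℂ (CuspForm (Gamma1 N) (n + 2))) :=
    (LinearMap.ker B.total).map P.total with hCdef
  have hsmul : ∀ φ : Module.Dual ℂ (CuspForm (Gamma1 N) (n + 2)),
      ((1 : ℚ) + (p : ℚ) ^ (n + 1)) • φ = c • φ := fun φ ↦ by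
    ext f
    change ((1 : ℚ) + (p : ℚ) ^ (n + 1)) • φ f = c * φ f
    rw [Rat.smul_def, hc]
    push_cast
    rfl
  have hgen : ∀ (σ : Gamma0 N) (q : Fin 2 → ℤ), Φ (periodFunctionalK1 n σ q) ∈ C := by
    intro σ q
    refine ⟨heckeChain n hp σ q - ((1 : ℚ) + (p : ℚ) ^ (n + 1)) • chainMM n (Gamma1 N) σ q, ?_, ?_⟩
    · rw [SetLike.mem_coe, LinearMap.mem_ker, map_sub, map_smul,
        total_bdry_heckeChain hp hle hn hn1 hneg hpN, sub_self]
    · rw [map_sub, map_smul, total_period_heckeChain n hp hpN, total_period_chainMM, hΦapply,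
        ← periodFunctionalK1_eq_pathFnl, hsmul]
  -- hence `Φ(ℚΛ) ≤ C`
  set Λ := Submodule.span ℚ (periodLatticeK1 (N := N) n :
    Set (Module.Dual ℂ (CuspForm (Gamma1 N) (n + 2)))) with hΛ
  have hmapΛ : Λ.map Φ ≤ C := by
    rw [hΛ, Submodule.map_span, Submodule.span_le]
    rintro _ ⟨φ, hφ, rfl⟩
    change φ ∈ periodLatticeK1 (N := N) n at hφ
    induction hφ using AddSubgroup.closure_induction with
    | mem x hx =>
      obtain ⟨⟨σ, q⟩, rfl⟩ := hx
      exact hgen σ q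
    | zero => rw [map_zero]; exact zero_mem _
    | add x y _ _ hx hy => rw [map_add]; exact add_mem hx hy
    | neg x _ hx => rw [map_neg]; exact neg_mem hx
  -- `C ≤ Pbar(ker Bbar)`
  set C' : Submodule ℚ (Module.Dual ℂ (CuspForm (Gamma1 N) (n + 2))) :=
    (LinearMap.ker Bbar).map Pbar with hC'def
  have hCC' : C ≤ C' := by
    rintro _ ⟨m, hm, rfl⟩
    refine ⟨Submodule.Quotient.mk m, ?_, ?_⟩
    · rw [SetLike.mem_coe, LinearMap.mem_ker, hBbar, Submodule.liftQ_apply]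
      exact hm
    · rw [hPbar, Submodule.liftQ_apply]
  -- dimensions
  have h1 : Module.finrank ℚ Λ = Module.finrank ℚ (Λ.map Φ) :=
    (LinearEquiv.finrank_eq (Submodule.equivMapOfInjective Φ hΦinj' Λ))
  have h2 : Module.finrank ℚ (Λ.map Φ) ≤ Module.finrank ℚ C' := Submodule.finrank_mono (hmapΛ.trans hCC')
  have h3 : Module.finrank ℚ C' ≤ Module.finrank ℚ (LinearMap.ker Bbar) := Submodule.finrank_map_le _ _
  have h4 := LinearMap.finrank_range_add_finrank_ker Bbar
  have h5 : LinearMap.range Bbar = Submodule.span ℚ (Set.range (tind Γ')) := by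
    rw [hBbar, Submodule.range_liftQ, hBdef, range_total_bdrySymbol]
  rw [h5] at h4
  omega

/-- **The sharp rank bound for the period lattice of `S_{n+2}(Γ₁(N))`** (`n ≥ 2` even, `N ≥ 4`,
`Γ₁(N) ≤ Γ' ∋ -1`): `12 (rank_ℤ Λ + #(⟨T⟩-orbits on SL(2, ℤ)/Γ')) ≤ (n + 1)[SL(2, ℤ) : Γ₁(N)]`,
the orbit count entering as `dim ⟨orbit indicators⟩`. For `Γ' = ±Γ₁(N)` the right side minus the
orbits is `24 dim_ℂ S_{n+2}(Γ₁(N))` by the dimension formula, giving `rank Λ ≤ 2 dim S` (sequel).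
[cite: ShimuraIATAF1971, §8.2 Thm. 8.4 and (8.2.23)] -/
theorem twelve_mul_finrank_add_card_le (hN : 4 ≤ N) :
    12 * (Module.finrank ℚ (Submodule.span ℚ (periodLatticeK1 (N := N) n :
        Set (Module.Dual ℂ (CuspForm (Gamma1 N) (n + 2))))) +
      Module.finrank ℚ (Submodule.span ℚ (Set.range (tind Γ')))) ≤ (n + 1) * (Gamma1 N).index :=
  (Nat.mul_le_mul_left 12 (finrank_span_periodLatticeK1_add_le N hle hn hn1 hneg)).trans
    (twelve_mul_finrank_quotient_le n (Gamma1 N) hn1 (gamma1_free hN))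

end Count

end ManinK

end Literature.NumberTheory.EllipticCurves.ModularForms
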